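import Literature.MathematicalPhysics.QuantumFieldTheory.Balaban1983to89.B9Eq3132DecayFromMajorant
import Literature.MathematicalPhysics.QuantumFieldTheory.Balaban1983to89.B9BackgroundsKLevelV1R

/-!
# `Balaban1983to89.B9Eq3132DecayFromMajorantR` — T. Bałaban, *Propagators for lattice gauge theories in a background field*, Commun. Math. Phys. **99** (1985)
# 389–434 [Balaban1985BackgroundPropagators], (3.132) p. 422 under Theorem 3.12's prefix p. 423: ROW 26's DECAY INPUTS RE-PRESSED ONCE OVER THE CLASS-PARAMETRIC
# CARRIER `bg9YR 𝔸 G R₁ R₂` (CASCADE-R STEP 2, n06-i share; the R-twins of `B9Eq3132DecayFromMajorant.decayUnder_QGQOfY_of_majorants` ∕ `majorants_of_step12`)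

[4] = T. Bałaban, *Propagators and renormalization transformations for lattice gauge theories. II*, Commun. Math. Phys. **96** (1984) 223–250 [`Balaban1984PropagatorsII`].

statement-level skeleton of published theorems with citation tags; proofs where landed; nothing here is a claim about the Yang–Mills mass gap

THE PRINT.  [B9] p. 422 (3.132) *«|(QG̃Q*)⁻¹(U; y, y′)|, |(QG₁Q*)⁻¹(U; y, y′)| ≦ O(1)(Lʲη)⁻²(L^{j′}η)^{−d} exp(−δ d(y, y′))»* under the prefix of Theorem 3.12 p. 423
*«If an external gauge field configuration U satisfies both regularity conditions (3.35), (3.36) for α₀ sufficiently small»*; p. 396 (3.35)–(3.36) (the regularity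
classes; *«U with values in G»*).

WHY THIS FILE (dag-n06-i gen 21; dag-n06-d g12 STEP-3 FACE CENSUS 2026-08-28 «`s3132Nu_opsYSectE_of_step12` [n06-i]: `bg9Y`-PINNED ✗, R-twin = object re-typing +
`MemOfFam`»; node00-def-Y g23 RULING (α1): the R-generic certificate is pressed ONCE at `B9PinCarriersKLevelV1R.carriersYR … R₁ R₂ ops`, objects AND premises over
`bg9YR 𝔸 G R₁ R₂ x := { bg9K 𝔸 G x.toKIdx with Reg335 := R₁ x, Reg336 := R₂ x }`, read at MODULE 3's families `(regY335, regY336)` by `rfl` today and at print's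
class `(regYP335, regYP336)` later).  Row 26's supplier chain below the knit face is `bg9Y`-pinned in two ways only: (i) its walk-model objects
`𝔬 : Ops (geo9Y x) (bg9Y 𝔸 G x) …` and class premises `(bg9Y 𝔸 G x).Reg335 ∕ .Reg336`, (ii) ONE class read, the `G`-valuedness `hU.1.1` of a (3.35) background
(for the contractivity of the bond transporters).  This file re-presses the two decay inputs with (i) re-typed over `bg9YR 𝔸 G R₁ R₂` and (ii) DISPLAYED as
def-Y's R-hypothesis `MemOfFam G R₁` (MODULE 3-R; `memOfFam_regY335` ∕ `memOfFam_regYP335` at the two readings) — the SAME proof texts otherwise; every class-blind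
lemma underneath (`norm_QGQOfY_deltaY_le`, `abs_normMatY_le`, `levelFactor_le`, `hasMajorant_G_G1_of_step`, `rowSum261_geo9Y`) is consumed BY NAME at
`B := bg9YR 𝔸 G R₁ R₂ x`.

WHAT IS PROVED (sorry-free, 0 def).
* §1 ★★ `decayUnder_QGQOfY_of_majorants_R (R₁ R₂) (hG : MemOfFam G R₁) …` — `DecayUnder c35 geo (bg9YR 𝔸 G R₁ R₂) (Λ-normalised Q_U T(U) Q*_U)` from a family of
  [4]-(2.51) block majorants of the coordinate models `GcoK … (bg9YR 𝔸 G R₁ R₂ x) (fun U => U) (T x) U` under the carrier's prefix (`R₁ x c35 α₀ U`, `R₂ x c35 α₀ U`).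
* §2 ★★ `majorants_of_step12_R (R₁ R₂) …` — those majorants for BOTH letters `T`, `T₁` from row 20's displayed inputs (Theorem 3.3 for `G₀`, the (3.131)∕(3.137)
  steps, `FormSmall`, `Identities`) for a walk model `𝔬 : Ops (geo9Y x) (bg9YR 𝔸 G R₁ R₂ x) …` at coordinate pins naming `T`, `T₁`; class-blind (no R-hypothesis).

HONEST SCOPE.  Re-typing bookkeeping (CASCADE-R STEP 2) of two LANDED derivations; the (3.35)∕(3.36) classes are PARAMETERS — the one class fact used
(`G`-valuedness) is a displayed hypothesis; nothing of [B9] or [4] is asserted; count-neutral; N06 NOT discharged; one finite 𝕋^{d+1} programme at fixed ε — nothing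
continuum, nothing OS, nothing about the mass gap.  Cell `pub-ymgap` (HUMAN RULING D-0062), Track A node N06 [B9], seat `pub-ymgap-dag-n06-i` (gen 21), 2026-08-28;
a NEW file (APPEND-ONLY companion of `B9Eq3132DecayFromMajorant`, untouched).
-/

noncomputable section

namespace Literature.MathematicalPhysics.QuantumFieldTheory.Balaban1983to89.B9Eq3132DecayFromMajorantR

open B6RandomWalk (HasMajorant hasMajorant_mono)
open B9CoReadingCoords (XBK blkBK GcoK)
open B9Thm39ReadingCoords (basisBound39)
open B6Ineq2142KLevelV1 (lvl β)
open B9Eq3132Ineq2142Covariant (norm_QGQOfY_deltaY_le abs_normMatY_le levelFactor_le)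
open B9Eq3132DecayFromMajorant (norm_basis_le hasMajorant_G_G1_of_step)
open Node00 (IBondY FBondY CfgY BondOpY BondParY deltaY QGQOfY)
open B6KLevelCensusIndexV1 (KIdx)
open B6GlobalChartV1 (blkV1)
open B9Thm34Ext (toB6)
open B9Thm312Whole (Ops Thm33G0 Step FormSmall Identities GeoOK)
open B11SectG (RowSum)
open B9PinMembersKLevelV1 (MemberY geo9Y bg9Y)
open B9BackgroundsKLevelV1R (RegFamY bg9YR MemOfFam mem_of_reg335R)
open B9GeoLemma21KLevelV1 (geo9K_len_pos rowSum261_geo9Y)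
open B9RWSumsReadsNbr (nbr)
open B9Eq3132RingInverseReading (normMatY dimConstY' dimConstY'_pos)
open B9Eq3132NuReading (lamInvY lamInvY_pos)
open B9Eq3132CTInputs (DecayUnder)
open B9Eq3132ScalarIndex (geoComap)

variable {𝔸 : Type} [NormedRing 𝔸] [NormedAlgebra ℂ 𝔸]
variable {κ : Type} [Fintype κ] [DecidableEq κ] {Ff : Type} [Fintype Ff] [DecidableEq Ff]
variable {d ℓ : ℕ} {hd : 1 ≤ d + 1} {hL : Odd (ℓ + 1) ∧ 1 < ℓ + 1} {b₀ b₁ : ℝ} {Mstar : ℕ}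
variable [CompleteSpace 𝔸] [FiniteDimensional ℝ 𝔸] {G : Subgroup 𝔸ˣ}

/-! ## §1 ★★ `DecayUnder` for the Λ-normalised `Q T(U) Q*` from the block majorants, at the class-parametric carrier -/

section Family

variable (R₁ R₂ : RegFamY d ℓ hd hL b₀ b₁ Mstar 𝔸)

/-- ★★ **`DecayUnder` FOR THE Λ-NORMALISED `Q_U T(U) Q*_U` FROM A FAMILY OF BLOCK MAJORANTS, AT THE CLASS-PARAMETRIC CARRIER `bg9YR 𝔸 G R₁ R₂`** — the R-twin of
`B9Eq3132DecayFromMajorant.decayUnder_QGQOfY_of_majorants` (same proof text; the premises `(bg9YR … x).Reg335 ∕ .Reg336 c35 α₀ U` are the parameters `R₁ ∕ R₂`,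
and the one class fact read — a background in the carrier's (3.35) is `G`-valued, for the contractivity `hparG` of the bond transporters — is the displayed
hypothesis `hG : MemOfFam G R₁`): the real matrix `diag(Λ⁻¹∕κ′)·reMatY(Q_U T(U) Q*_U)·diag(Λ⁻¹)` decays like `B·e^{−(δ∕2)d}` above `max(M₂, (d+3)log L ∕ (δ(2L²−1)))`.
[cite: Balaban1985BackgroundPropagators, (3.132) p.422, Thm 3.12 p.423 (prefix), (3.35)–(3.36) p.396; Balaban1984PropagatorsII, (2.142) p.248, (2.149) p.249, Lemma 2.1 (2.60) p.234] -/
theorem decayUnder_QGQOfY_of_majorants_R (hG : MemOfFam G R₁) [∀ x : MemberY d ℓ hd hL b₀ b₁ Mstar, Fintype (geo9Y x).Site]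
    [∀ x : MemberY d ℓ hd hL b₀ b₁ Mstar, DecidableEq (geo9Y x).Site] (bK : Module.Basis κ ℝ 𝔸) (b : Module.Basis Ff ℝ 𝔸) {c35 : ℝ}
    (T : ∀ x : MemberY d ℓ hd hL b₀ b₁ Mstar, BondOpY 𝔸 x.toKIdx) (parB : ∀ x : MemberY d ℓ hd hL b₀ b₁ Mstar, BondParY 𝔸 x.toKIdx)
    (hparG : ∀ (x : MemberY d ℓ hd hL b₀ b₁ Mstar) (U : CfgY 𝔸 x.toKIdx), (∀ μ y, U μ y ∈ G) →
      ∀ s s', ‖(parB x U s s' : 𝔸)‖ ≤ 1 ∧ ‖(((parB x U s s')⁻¹ : 𝔸ˣ) : 𝔸)‖ ≤ 1)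
    {bI : ∀ x : MemberY d ℓ hd hL b₀ b₁ Mstar, FBondY x.toKIdx → IBondY x.toKIdx}
    (hlev : ∀ (x : MemberY d ℓ hd hL b₀ b₁ Mstar) (f : FBondY x.toKIdx), lvl x.hN x.D x.hk (bI x f) = (blkV1 x.hN x.D f).1.1)
    (hβ1 : ∀ (x : MemberY d ℓ hd hL b₀ b₁ Mstar) (f : FBondY x.toKIdx), (B6Geom246MultiLevelTorus.geomT x.D).dist (β x.hN x.D x.hk (bI x f)) (blkV1 x.hN x.D f) ≤ 1)
    {mN : ℕ} (hnbr : ∀ (x : MemberY d ℓ hd hL b₀ b₁ Mstar) (y : (geo9Y x).Site), (nbr (geo9Y x) ((ℓ : ℝ) + 4) y).card ≤ mN)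
    {R : MemberY d ℓ hd hL b₀ b₁ Mstar → ℝ} {H : MemberY d ℓ hd hL b₀ b₁ Mstar → Prop}
    (h : ∃ M₂ a₂ C δ : ℝ, 0 < M₂ ∧ 0 < a₂ ∧ 0 ≤ C ∧ 0 < δ ∧
      ∀ x : MemberY d ℓ hd hL b₀ b₁ Mstar, M₂ ≤ (geo9Y x).M → ∀ α₀ : ℝ, 0 < α₀ → (geo9Y x).M * α₀ ≤ a₂ →
        ∀ U : (bg9YR 𝔸 G R₁ R₂ x).Cfg, (bg9YR 𝔸 G R₁ R₂ x).Reg335 c35 α₀ U → (bg9YR 𝔸 G R₁ R₂ x).Reg336 c35 α₀ U →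
          HasMajorant (g := toB6 (geo9Y x) (R x) (H x)) (blkBK x.toKIdx (bI x)) (GcoK x.toKIdx bK (bg9YR 𝔸 G R₁ R₂ x) (fun U => U) (T x) U)
            (fun a a' => C * (geo9Y x).len a ^ 2 * Real.exp (-(δ * (geo9Y x).dist a a')))) :
    DecayUnder c35 (fun x : MemberY d ℓ hd hL b₀ b₁ Mstar => geoComap (geo9Y x) (Prod.fst : (geo9Y x).Site × Ff → (geo9Y x).Site))
      (bg9YR 𝔸 G R₁ R₂) (fun x U => normMatY b (lamInvY x.toKIdx) (QGQOfY x.toKIdx (parB x) (T x) U)) := by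
  obtain ⟨M₂, a₂, C, δ, hM₂, ha₂, hC, hδ, hmaj⟩ := h
  -- the constants: the (2.60) threshold, the prefactor
  set L : ℝ := ((ℓ + 1 : ℕ) : ℝ) with hLdef
  have hL1 : (1 : ℝ) ≤ L := by rw [hLdef]; exact_mod_cast Nat.succ_le_succ (Nat.zero_le ℓ)
  set MT : ℝ := ((d : ℝ) + 3) * Real.log L / (δ * (2 * ((ℓ : ℝ) + 1) ^ 2 - 1)) with hMT
  have hden : 0 < δ * (2 * ((ℓ : ℝ) + 1) ^ 2 - 1) := mul_pos hδ (by nlinarith [(Nat.cast_nonneg ℓ : (0 : ℝ) ≤ ℓ)])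
  set B : ℝ := basisBound39 b * (‖(b.equivFunL : 𝔸 →L[ℝ] (Ff → ℝ))‖ / dimConstY' b) * (mN * C * Real.exp (2 * (δ * ((ℓ : ℝ) + 4)))) *
    L ^ (((d : ℝ) + 3) / 2) with hB
  have hB0 : 0 ≤ B := by
    rw [hB]
    have : 0 ≤ basisBound39 b := Finset.sum_nonneg fun _ _ => norm_nonneg _
    have := dimConstY'_pos b
    positivity
  refine ⟨max M₂ MT, a₂, B, δ / 2, lt_of_lt_of_le hM₂ (le_max_left _ _), ha₂, hB0, half_pos hδ, fun x hM α₀ hα₀ hMa U hU hU' a c => ?_⟩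
  have hM2 : M₂ ≤ (geo9Y x).M := (le_max_left _ _).trans hM
  have hMTx : MT ≤ (geo9Y x).M := (le_max_right _ _).trans hM
  have h0 := hmaj x hM2 α₀ hα₀ hMa U hU hU'
  -- the ONE class read: `G`-valuedness, from the displayed `MemOfFam G R₁`
  have hUG : ∀ μ y, U μ y ∈ G := mem_of_reg335R hG x hU
  have hpar := hparG x U hUG
  -- (2.142) at `U` for the block entry on the basis direction `b c.2`
  have h2142 := norm_QGQOfY_deltaY_le (κ := κ) x.toKIdx (instF := (inferInstance : Fintype (geo9Y x).Site)) bK (B := bg9YR 𝔸 G R₁ R₂ x)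
    (fun U => U) (T x) (parB x) U (hlev x) (hβ1 x) (hnbr x) hpar hC hδ.le h0 a.1 c.1 (b c.2)
  -- the normalised entry through the block entry
  have h4 := abs_normMatY_le (X := (geo9Y x).Site) b (fun y => (lamInvY_pos x.toKIdx y).le) (QGQOfY x.toKIdx (parB x) (T x) U) a c
  -- the level factor under the (2.60) threshold
  have hlog : ((d : ℝ) + 3) * Real.log (geo9Y x).L ≤ δ * (2 * ((ℓ : ℝ) + 1) ^ 2 - 1) * (geo9Y x).M := by
    have h1 : ((d : ℝ) + 3) * Real.log L = MT * (δ * (2 * ((ℓ : ℝ) + 1) ^ 2 - 1)) := by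
      rw [hMT, div_mul_cancel₀ _ hden.ne']
    have hLx : (geo9Y x).L = L := rfl
    rw [hLx, h1, mul_comm]
    exact mul_le_mul_of_nonneg_left hMTx hden.le
  have h5 := levelFactor_le x.toKIdx hδ hlog a.1 c.1
  -- assemble (all lengths and distances in the `geo9Y x` spelling; plain real arithmetic on atoms)
  have hκ := dimConstY'_pos b
  have hrepr : 0 ≤ ‖(b.equivFunL : 𝔸 →L[ℝ] (Ff → ℝ))‖ / dimConstY' b := div_nonneg (norm_nonneg _) hκ.le
  have hbb0 : 0 ≤ basisBound39 b := Finset.sum_nonneg fun _ _ => norm_nonneg _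
  have hbf : ‖b c.2‖ ≤ basisBound39 b := norm_basis_le b c.2
  have hdist : (geoComap (geo9Y x) (Prod.fst : (geo9Y x).Site × Ff → (geo9Y x).Site)).dist a c = (geo9Y x).dist a.1 c.1 := rfl
  rw [hdist]
  have h2142' : ‖QGQOfY x.toKIdx (parB x) (T x) U (deltaY c.1 (b c.2)) a.1‖ ≤
      mN * C * Real.exp (2 * (δ * ((ℓ : ℝ) + 4))) * (geo9Y x).len a.1 ^ 2 * ((((ℓ + 1 : ℕ) : ℝ) ^ (d + 1)) ^ (lvl x.hN x.D x.hk c.1))⁻¹ *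
        Real.exp (-(δ * (geo9Y x).dist a.1 c.1)) * ‖b c.2‖ := h2142
  have h5' : lamInvY x.toKIdx a.1 * lamInvY x.toKIdx c.1 * (geo9Y x).len a.1 ^ 2 * ((((ℓ + 1 : ℕ) : ℝ) ^ (d + 1)) ^ (lvl x.hN x.D x.hk c.1))⁻¹ ≤
      L ^ (((d : ℝ) + 3) / 2) * Real.exp (δ / 2 * (geo9Y x).dist a.1 c.1) := h5
  -- chain the two estimates (the block entry is eliminated), then name the remaining atoms
  have s12 := h4.trans (mul_le_mul_of_nonneg_left h2142'
    (mul_nonneg (mul_nonneg (lamInvY_pos x.toKIdx a.1).le (lamInvY_pos x.toKIdx c.1).le) hrepr))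
  generalize hΛa : lamInvY x.toKIdx a.1 = Λa at h5' s12
  generalize hΛc : lamInvY x.toKIdx c.1 = Λc at h5' s12
  generalize hla : (geo9Y x).len a.1 = la at s12 h5'
  generalize hpw : ((((ℓ + 1 : ℕ) : ℝ) ^ (d + 1)) ^ (lvl x.hN x.D x.hk c.1))⁻¹ = pw at s12 h5'
  generalize hD : (geo9Y x).dist a.1 c.1 = D at s12 h5' ⊢
  generalize hr : ‖(b.equivFunL : 𝔸 →L[ℝ] (Ff → ℝ))‖ / dimConstY' b = r at s12 hrepr hB
  generalize hK : (mN : ℝ) * C * Real.exp (2 * (δ * ((ℓ : ℝ) + 4))) = K at s12 hB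
  generalize hnb : ‖b c.2‖ = nb at s12 hbf
  generalize hLB : L ^ (((d : ℝ) + 3) / 2) = LB at h5' hB
  have hK0 : 0 ≤ K := by rw [← hK]; positivity
  have hΛa0 : 0 ≤ Λa := by rw [← hΛa]; exact (lamInvY_pos _ _).le
  have hΛc0 : 0 ≤ Λc := by rw [← hΛc]; exact (lamInvY_pos _ _).le
  have hpw0 : 0 ≤ pw := by rw [← hpw]; positivity
  have s3 : Λa * Λc * r * (K * la ^ 2 * pw * Real.exp (-(δ * D)) * nb) = r * K * nb * (Λa * Λc * la ^ 2 * pw) * Real.exp (-(δ * D)) := by ring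
  have s4 : r * K * nb * (Λa * Λc * la ^ 2 * pw) * Real.exp (-(δ * D)) ≤ r * K * basisBound39 b * (LB * Real.exp (δ / 2 * D)) * Real.exp (-(δ * D)) := by
    refine mul_le_mul_of_nonneg_right ?_ (Real.exp_nonneg _)
    exact mul_le_mul (mul_le_mul_of_nonneg_left hbf (mul_nonneg hrepr hK0)) h5'
      (mul_nonneg (mul_nonneg (mul_nonneg hΛa0 hΛc0) (sq_nonneg _)) hpw0) (mul_nonneg (mul_nonneg hrepr hK0) hbb0)
  have s5 : r * K * basisBound39 b * (LB * Real.exp (δ / 2 * D)) * Real.exp (-(δ * D)) = B * Real.exp (-(δ / 2 * D)) := by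
    rw [hB, show Real.exp (-(δ / 2 * D)) = Real.exp (δ / 2 * D) * Real.exp (-(δ * D)) by
      rw [← Real.exp_add]; congr 1; ring]
    ring
  exact s12.trans (s3.le.trans (s4.trans s5.le))

end Family

/-! ## §2 ★★ The majorants from ROW 20's displayed inputs, for a walk model over the class-parametric carrier -/

section FromStepFamily

variable (R₁ R₂ : RegFamY d ℓ hd hL b₀ b₁ Mstar 𝔸)
variable {Y Z W : MemberY d ℓ hd hL b₀ b₁ Mstar → Type} [∀ x, Fintype (Z x)] [∀ x, Fintype (W x)]

/-- a small product: `0 ≤ t`, `m ≤ (2(t+1))⁻¹` ⇒ `t·m ≤ ½`. [folklore] -/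
private theorem small_aux {t m : ℝ} (ht : 0 ≤ t) (hm : m ≤ (2 * (t + 1))⁻¹) : t * m ≤ 1 / 2 := by
  have h1 : t * m ≤ t * (2 * (t + 1))⁻¹ := mul_le_mul_of_nonneg_left hm ht
  have h2 : t * (2 * (t + 1))⁻¹ ≤ 1 / 2 := by
    rw [← div_eq_mul_inv, div_le_iff₀ (by positivity)]
    nlinarith
  exact h1.trans h2

omit [DecidableEq κ] in
/-- ★★ **THE FAMILY OF MAJORANTS OF THE GENUINE LETTERS FROM ROW 20's DISPLAYED INPUTS, FOR A WALK MODEL OVER THE CLASS-PARAMETRIC CARRIER** — the R-twin of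
`B9Eq3132DecayFromMajorant.majorants_of_step12` (same proof text; `𝔬 : Ops (geo9Y x) (bg9YR 𝔸 G R₁ R₂ x) …`, the pins and the displayed `hmodel` read at the
carrier, whose (3.35)∕(3.36) premises are the parameters `R₁ ∕ R₂`; class-blind — no R-hypothesis): above `max(M₁, M_L)` and for `Mα₀ ≤ min(a₁, (2(θ₁c+1))⁻¹)`, the
[4]-(2.51) majorant `2B₀(Lʲη)²e^{−ρd}` of BOTH coordinate models `GcoK … (T x) U`, `GcoK … (T₁ x) U`.
[cite: Balaban1985BackgroundPropagators, Thm 3.12 p.423, (3.130) p.421, (3.138) p.423, (3.35)–(3.36) p.396; Balaban1984PropagatorsII, (2.51) p.232, Lemma 2.1 (2.61) p.234] -/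
theorem majorants_of_step12_R [∀ x : MemberY d ℓ hd hL b₀ b₁ Mstar, Fintype (geo9Y x).Site] (bK : Module.Basis κ ℝ 𝔸) {c35 : ℝ}
    (𝔬 : ∀ x : MemberY d ℓ hd hL b₀ b₁ Mstar, Ops (geo9Y x) (bg9YR 𝔸 G R₁ R₂ x) (XBK κ x.toKIdx) (Y x) (Z x) (W x))
    (H₀ : MemberY d ℓ hd hL b₀ b₁ Mstar → Prop) (T T₁ : ∀ x : MemberY d ℓ hd hL b₀ b₁ Mstar, BondOpY 𝔸 x.toKIdx)
    {bI : ∀ x : MemberY d ℓ hd hL b₀ b₁ Mstar, FBondY x.toKIdx → IBondY x.toKIdx}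
    (hblk : ∀ x, (𝔬 x).blk = blkBK x.toKIdx (bI x))
    (hGco : ∀ (x : MemberY d ℓ hd hL b₀ b₁ Mstar) (U : (bg9YR 𝔸 G R₁ R₂ x).Cfg), (𝔬 x).G U = GcoK x.toKIdx bK (bg9YR 𝔸 G R₁ R₂ x) (fun U => U) (T x) U)
    (hG1co : ∀ (x : MemberY d ℓ hd hL b₀ b₁ Mstar) (U : (bg9YR 𝔸 G R₁ R₂ x).Cfg), (𝔬 x).G1 U = GcoK x.toKIdx bK (bg9YR 𝔸 G R₁ R₂ x) (fun U => U) (T₁ x) U)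
    (θ₁ r₁ B₀ δ₀ δK σ ρ a₁ M₁ : ℝ) (hθ₁ : 0 ≤ θ₁) (hB₀ : 0 ≤ B₀) (hσ : 0 < σ) (hρ : 0 < ρ) (hρS : ρ ≤ δ₀) (hρδ : ρ + σ ≤ δK)
    (ha₁ : 0 < a₁) (hM₁ : 0 < M₁) (hgeo : ∀ x : MemberY d ℓ hd hL b₀ b₁ Mstar, GeoOK (geo9Y x))
    (hmodel : ∀ x : MemberY d ℓ hd hL b₀ b₁ Mstar, M₁ ≤ (geo9Y x).M → ∀ α₀ : ℝ, 0 < α₀ → (geo9Y x).M * α₀ ≤ a₁ →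
      ∀ U : (bg9YR 𝔸 G R₁ R₂ x).Cfg, (bg9YR 𝔸 G R₁ R₂ x).Reg335 c35 α₀ U → (bg9YR 𝔸 G R₁ R₂ x).Reg336 c35 α₀ U →
        Thm33G0 (𝔬 x) 1 (H₀ x) B₀ δ₀ U ∧
        Step (𝔬 x) 1 (H₀ x) (hgeo x).lenle 1 (θ₁ * ((geo9Y x).M * α₀)) δK U ∧
        Step (𝔬 x) 1 (H₀ x) (hgeo x).lenle 2 (θ₁ * ((geo9Y x).M * α₀)) δK U ∧
        FormSmall (𝔬 x) (r₁ * ((geo9Y x).M * α₀)) U ∧ Identities (𝔬 x) U) :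
    ∃ M₂ a₂ C δ : ℝ, 0 < M₂ ∧ 0 < a₂ ∧ 0 ≤ C ∧ 0 < δ ∧
      ∀ x : MemberY d ℓ hd hL b₀ b₁ Mstar, M₂ ≤ (geo9Y x).M → ∀ α₀ : ℝ, 0 < α₀ → (geo9Y x).M * α₀ ≤ a₂ →
        ∀ U : (bg9YR 𝔸 G R₁ R₂ x).Cfg, (bg9YR 𝔸 G R₁ R₂ x).Reg335 c35 α₀ U → (bg9YR 𝔸 G R₁ R₂ x).Reg336 c35 α₀ U →
          HasMajorant (g := toB6 (geo9Y x) 1 (H₀ x)) (blkBK x.toKIdx (bI x)) (GcoK x.toKIdx bK (bg9YR 𝔸 G R₁ R₂ x) (fun U => U) (T x) U)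
              (fun a a' => C * (geo9Y x).len a ^ 2 * Real.exp (-(δ * (geo9Y x).dist a a'))) ∧
            HasMajorant (g := toB6 (geo9Y x) 1 (H₀ x)) (blkBK x.toKIdx (bI x)) (GcoK x.toKIdx bK (bg9YR 𝔸 G R₁ R₂ x) (fun U => U) (T₁ x) U)
              (fun a a' => C * (geo9Y x).len a ^ 2 * Real.exp (-(δ * (geo9Y x).dist a a'))) := by
  -- (2.61) for the record geometry at rate σ, constant `max c 0`
  obtain ⟨ML, c, hrow0⟩ := rowSum261_geo9Y (d := d) (ℓ := ℓ) (hd := hd) (hL := hL) (b₀ := b₀) (b₁ := b₁) (Mstar := Mstar) σ hσ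
  set c' : ℝ := max c 0 with hc'
  have hc'0 : 0 ≤ c' := le_max_right _ _
  have hrow : ∀ x : MemberY d ℓ hd hL b₀ b₁ Mstar, ML ≤ (geo9Y x).M → RowSum (toB6 (geo9Y x) 1 (H₀ x)) σ c' :=
    fun x hM y => (hrow0 x hM y).trans (le_max_left _ _)
  set a₂ : ℝ := min a₁ (2 * (θ₁ * c' + 1))⁻¹ with ha₂
  have ha₂0 : 0 < a₂ := lt_min ha₁ (inv_pos.2 (by positivity))
  refine ⟨max M₁ ML, a₂, 2 * B₀, ρ, lt_of_lt_of_le hM₁ (le_max_left _ _), ha₂0, by positivity, hρ, fun x hM α₀ hα₀ hMa U hU hU' => ?_⟩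
  have hM1 : M₁ ≤ (geo9Y x).M := (le_max_left _ _).trans hM
  have hMLx : ML ≤ (geo9Y x).M := (le_max_right _ _).trans hM
  have hMa1 : (geo9Y x).M * α₀ ≤ a₁ := hMa.trans (min_le_left _ _)
  obtain ⟨h33, _, hst, _, hI⟩ := hmodel x hM1 α₀ hα₀ hMa1 U hU hU'
  -- the smallness `θ₁(Mα₀)c′ ≤ ½`
  have hMα0 : 0 ≤ (geo9Y x).M * α₀ := mul_nonneg (hM₁.le.trans hM1) hα₀.le
  have hsmall : θ₁ * ((geo9Y x).M * α₀) * c' ≤ 1 / 2 := by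
    have h := small_aux (t := θ₁ * c') (m := (geo9Y x).M * α₀) (by positivity) (hMa.trans (min_le_right _ _))
    calc θ₁ * ((geo9Y x).M * α₀) * c' = θ₁ * c' * ((geo9Y x).M * α₀) := by ring
      _ ≤ 1 / 2 := h
  have hq : θ₁ * ((geo9Y x).M * α₀) * c' < 1 := lt_of_le_of_lt hsmall (by norm_num)
  have hθ : 0 ≤ θ₁ * ((geo9Y x).M * α₀) := mul_nonneg hθ₁ hMα0
  obtain ⟨hG0, hG1⟩ := hasMajorant_G_G1_of_step (hgeo x) (𝔬 x) (hrow x hMLx) hθ hB₀ hρ.le hρS hρδ hq h33 hst hI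
  -- the constant `B₀(1 − q)⁻¹ ≤ 2B₀`
  have hinv : (1 - θ₁ * ((geo9Y x).M * α₀) * c')⁻¹ ≤ 2 := by
    rw [inv_le_comm₀ (by linarith) (by norm_num)]
    linarith
  have hle : ∀ a a' : (geo9Y x).Site, B₀ * (1 - θ₁ * ((geo9Y x).M * α₀) * c')⁻¹ * (geo9Y x).len a ^ 2 * Real.exp (-(ρ * (geo9Y x).dist a a')) ≤
      2 * B₀ * (geo9Y x).len a ^ 2 * Real.exp (-(ρ * (geo9Y x).dist a a')) := by
    intro a a'
    have h0 : 0 ≤ (geo9Y x).len a ^ 2 * Real.exp (-(ρ * (geo9Y x).dist a a')) := by positivity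
    calc B₀ * (1 - θ₁ * ((geo9Y x).M * α₀) * c')⁻¹ * (geo9Y x).len a ^ 2 * Real.exp (-(ρ * (geo9Y x).dist a a'))
        = (B₀ * (1 - θ₁ * ((geo9Y x).M * α₀) * c')⁻¹) * ((geo9Y x).len a ^ 2 * Real.exp (-(ρ * (geo9Y x).dist a a'))) := by ring
      _ ≤ (B₀ * 2) * ((geo9Y x).len a ^ 2 * Real.exp (-(ρ * (geo9Y x).dist a a'))) :=
          mul_le_mul_of_nonneg_right (mul_le_mul_of_nonneg_left hinv hB₀) h0
      _ = _ := by ring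
  rw [hblk x] at hG0 hG1
  rw [hGco x U] at hG0
  rw [hG1co x U] at hG1
  exact ⟨hasMajorant_mono (g := toB6 (geo9Y x) 1 (H₀ x)) _ hG0 hle, hasMajorant_mono (g := toB6 (geo9Y x) 1 (H₀ x)) _ hG1 hle⟩

end FromStepFamily

end Literature.MathematicalPhysics.QuantumFieldTheory.Balaban1983to89.B9Eq3132DecayFromMajorantR

end
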